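import Summits.CriticalPhenomena.PercolationContinuityZ3.Theorems.SahiAEBorelVersionPosPi

/-!
# Uniformly positive Borel everywhere-MTP₂ / supermodular versions: corollaries (densities w.r.t. a product, a.e.-bounded functions, the unit cube `Q_ι`)

Support file of the Sahi cell (`prim-sahi`, typer seat, generation 22; `--supports stmt-CriticalPhenomena-4575`).
Theorems only (no definitions, no named facts, no sorries).

Corollaries of `hasPosBorelMTP2Versions_pi` (`SahiAEBorelVersionPosPi.lean`):

* `hasPosBorelMTP2Versions_withDensity_pi` / `_withDensity_volume` — every reference measure with an a.e.-positive
  density with respect to a finite product of σ-finite measures on `ℝ` (two-sided property is invariant under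
  equivalence of measures);
* `exists_measurable_supermodular_version_of_ae_pi'` — the additive version theorem with the bound `|φ| ≤ K` assumed
  only almost everywhere (modification on a null set; quasi-invariance of `π ⊗ π` under `∧`, `∨`);
* `exists_pos_measurable_mtp2_density_of_isBoxTP2` — an MTP₂ LAW (box-TP₂ measure `π·f`, `f ∈ [c, M]` integrable,
  `π = ⊗ρᵢ` locally finite) has an everywhere-MTP₂ Borel density BOUNDED AWAY FROM `0` AND `∞` (two-sided form of
  g21's `exists_measurable_mtp2_density_of_isBoxTP2`);
* `hasPosBorelMTP2Versions_volume_unitCube` — Lebesgue measure on the closed unit cube `ι → [0,1]` (the cell's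
  `Q_ι`), by the two-sided transport along the coordinatewise projection `projIcc` (a lattice homomorphism
  `ℝ^ι → [0,1]^ι` at every pair) and the inclusion (a lattice homomorphism at every pair, measure preserving);
  unfolded: `exists_pos_measurable_mtp2_version_of_ae_unitCube`;
* `exists_measurable_supermodular_version_of_ae_unitCube` — the additive form on `Q_ι`: a bounded measurable
  `φ : Q_ι → ℝ` supermodular on Lebesgue-a.e. pair has a bounded Borel version supermodular at every pair.

No sorries, no new axioms.
-/

noncomputable section

namespace Summit.CriticalPhenomena.PercolationContinuityZ3.Theorems.SahiAEFourFunctions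

open MeasureTheory Set Filter Topology
open Summit.CriticalPhenomena.PercolationContinuityZ3.Theorems.SahiBoxTP2 (IsBoxTP2)
open scoped ENNReal NNReal unitInterval

variable {ι : Type*} [Fintype ι]

/-! ### Reference measures with a positive density with respect to a product measure -/

/-- **Every reference measure with an a.e.-positive density with respect to a finite product of σ-finite measures on
`ℝ`** has the two-sided Borel-version property. [this work] -/
theorem hasPosBorelMTP2Versions_withDensity_pi (ρ : ι → Measure ℝ) [∀ i, SigmaFinite (ρ i)] {h : (ι → ℝ) → ℝ≥0∞}
    (hh : Measurable h) (h0 : ∀ᵐ x ∂Measure.pi ρ, h x ≠ 0) :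
    HasPosBorelMTP2Versions ((Measure.pi ρ).withDensity h) :=
  (hasPosBorelMTP2Versions_pi ρ).of_equivalent (withDensity_absolutelyContinuous _ _)
    (withDensity_absolutelyContinuous' hh.aemeasurable h0)

/-- In particular `volume.withDensity h` for every measurable a.e.-positive `h` on `ℝ^ι`. [this work] -/
theorem hasPosBorelMTP2Versions_withDensity_volume {h : (ι → ℝ) → ℝ≥0∞} (hh : Measurable h)
    (h0 : ∀ᵐ x ∂(volume : Measure (ι → ℝ)), h x ≠ 0) :
    HasPosBorelMTP2Versions ((volume : Measure (ι → ℝ)).withDensity h) :=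
  hasPosBorelMTP2Versions_volume.of_equivalent (withDensity_absolutelyContinuous _ _)
    (withDensity_absolutelyContinuous' hh.aemeasurable h0)

/-! ### The additive form with an almost-everywhere bound -/

/-- **Essentially bounded a.e.-supermodular functions.**  For `ρᵢ` σ-finite on `ℝ`, a measurable `φ : ℝ^ι → ℝ` with
`|φ| ≤ K` ALMOST everywhere and `φ(x) + φ(y) ≤ φ(x ∧ y) + φ(x ∨ y)` for `(⊗ρᵢ) ⊗ (⊗ρᵢ)`-a.e. `(x, y)` has a bounded
Borel version supermodular at every pair (modify `φ` to `0` on the exceptional null set first: almost every pair has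
its members, meet and join outside it, `ae_prod_mem_inf_sup_of_sigmaFinite`). [this work] -/
theorem exists_measurable_supermodular_version_of_ae_pi' (ρ : ι → Measure ℝ) [∀ i, SigmaFinite (ρ i)]
    (φ : (ι → ℝ) → ℝ) (hφ : Measurable φ) {K : ℝ} (hK : ∀ᵐ x ∂Measure.pi ρ, |φ x| ≤ K)
    (hsm : ∀ᵐ p ∂(Measure.pi ρ).prod (Measure.pi ρ), φ p.1 + φ p.2 ≤ φ (p.1 ⊓ p.2) + φ (p.1 ⊔ p.2)) :
    ∃ ψ : (ι → ℝ) → ℝ, Measurable ψ ∧ (∃ K' : ℝ, ∀ x, |ψ x| ≤ K') ∧ ψ =ᵐ[Measure.pi ρ] φ ∧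
      ∀ x y, ψ x + ψ y ≤ ψ (x ⊓ y) + ψ (x ⊔ y) := by
  set G : Set (ι → ℝ) := {x | |φ x| ≤ K} with hG
  have mG : MeasurableSet G := measurableSet_le (continuous_abs.measurable.comp hφ) measurable_const
  set φ' : (ι → ℝ) → ℝ := G.piecewise φ (fun _ => 0) with hφ'
  have hφ'm : Measurable φ' := hφ.piecewise mG measurable_const
  have h_of_mem : ∀ x ∈ G, φ' x = φ x := fun x hx => Set.piecewise_eq_of_mem _ _ _ hx
  have h_of_not_mem : ∀ x ∉ G, φ' x = 0 := fun x hx => Set.piecewise_eq_of_notMem _ _ _ hx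
  have hK' : ∀ x, |φ' x| ≤ max K 0 := fun x => by
    by_cases hx : x ∈ G
    · rw [h_of_mem x hx]; exact (show |φ x| ≤ K from hx).trans (le_max_left _ _)
    · rw [h_of_not_mem x hx, abs_zero]; exact le_max_right _ _
  have hφ'φ : φ' =ᵐ[Measure.pi ρ] φ := by
    filter_upwards [hK] with x hx using h_of_mem x hx
  have hsm' : ∀ᵐ p ∂(Measure.pi ρ).prod (Measure.pi ρ), φ' p.1 + φ' p.2 ≤ φ' (p.1 ⊓ p.2) + φ' (p.1 ⊔ p.2) := by
    filter_upwards [hsm, ae_prod_mem_inf_sup_of_sigmaFinite ρ (G := G) hK] with p hp hG4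
    rw [h_of_mem _ hG4.1.1, h_of_mem _ hG4.1.2, h_of_mem _ hG4.2.1, h_of_mem _ hG4.2.2]
    exact hp
  obtain ⟨ψ, hψm, hψb, hψφ', hψsm⟩ := exists_measurable_supermodular_version_of_ae_pi ρ φ' hφ'm hK' hsm'
  exact ⟨ψ, hψm, hψb, hψφ'.trans hφ'φ, hψsm⟩

/-! ### MTP₂ laws have everywhere-MTP₂ densities bounded away from `0` and `∞` -/

/-- **An MTP₂ law with a density bounded away from `0` and `∞` has an everywhere-MTP₂ Borel density with two-sided
bounds.**  For `π = ⊗ᵢ ρᵢ` (locally finite `ρᵢ` on `ℝ`) and a measurable integrable `f : ℝ^ι → [c, M]` (`0 < c`,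
`M < ∞`): if the law `π·f` is box-TP₂ (`IsBoxTP2`; ⟺ set-TP₂ ⟺ affiliated), then `π·f = π·F` for a Borel `F`,
`0 < c' ≤ F ≤ M' < ∞`, with `F(x) F(y) ≤ F(x ∧ y) F(x ∨ y)` at EVERY pair. [this work] -/
theorem exists_pos_measurable_mtp2_density_of_isBoxTP2 (ρ : ι → Measure ℝ) [∀ i, IsLocallyFiniteMeasure (ρ i)]
    (f : (ι → ℝ) → ℝ≥0∞) (hf : Measurable f) (hfin : ∫⁻ z, f z ∂Measure.pi ρ ≠ ∞) {c M : ℝ≥0∞} (hc : c ≠ 0)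
    (hM : M ≠ ∞) (hcf : ∀ x, c ≤ f x) (hfM : ∀ x, f x ≤ M) (h : IsBoxTP2 ((Measure.pi ρ).withDensity f)) :
    ∃ F : (ι → ℝ) → ℝ≥0∞, Measurable F ∧ (∃ c' M' : ℝ≥0∞, c' ≠ 0 ∧ M' ≠ ∞ ∧ ∀ x, c' ≤ F x ∧ F x ≤ M') ∧
      (Measure.pi ρ).withDensity F = (Measure.pi ρ).withDensity f ∧ ∀ x y, F x * F y ≤ F (x ⊓ y) * F (x ⊔ y) := by
  obtain ⟨F, hFm, hFb, hFf, hFmtp⟩ := exists_pos_measurable_mtp2_version_of_ae_pi ρ f hf hc hM hcf hfM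
    ((isBoxTP2_withDensity_pi_iff_ae ρ f hf hfin).1 h)
  exact ⟨F, hFm, hFb, withDensity_congr_ae hFf, hFmtp⟩

/-! ### The closed unit cube `ι → [0,1]` -/

omit [Fintype ι] in
/-- The coordinatewise projection `ℝ^ι → [0,1]^ι` is a lattice homomorphism at every pair. [folklore] -/
theorem projIcc_pi_lattice (x y : ι → ℝ) :
    (fun i => projIcc (0 : ℝ) 1 zero_le_one ((x ⊓ y) i)) =
        (fun i => projIcc (0 : ℝ) 1 zero_le_one (x i)) ⊓ (fun i => projIcc (0 : ℝ) 1 zero_le_one (y i)) ∧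
      (fun i => projIcc (0 : ℝ) 1 zero_le_one ((x ⊔ y) i)) =
        (fun i => projIcc (0 : ℝ) 1 zero_le_one (x i)) ⊔ (fun i => projIcc (0 : ℝ) 1 zero_le_one (y i)) := by
  refine ⟨funext fun i => ?_, funext fun i => ?_⟩
  · show projIcc (0 : ℝ) 1 zero_le_one (x i ⊓ y i) =
      projIcc (0 : ℝ) 1 zero_le_one (x i) ⊓ projIcc (0 : ℝ) 1 zero_le_one (y i)
    refine le_antisymm (le_inf (monotone_projIcc _ inf_le_left) (monotone_projIcc _ inf_le_right)) ?_
    rcases le_total (x i) (y i) with h | h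
    · rw [inf_eq_left.2 h]; exact inf_le_left
    · rw [inf_eq_right.2 h]; exact inf_le_right
  · show projIcc (0 : ℝ) 1 zero_le_one (x i ⊔ y i) =
      projIcc (0 : ℝ) 1 zero_le_one (x i) ⊔ projIcc (0 : ℝ) 1 zero_le_one (y i)
    refine le_antisymm ?_ (sup_le (monotone_projIcc _ le_sup_left) (monotone_projIcc _ le_sup_right))
    rcases le_total (x i) (y i) with h | h
    · rw [sup_eq_right.2 h]; exact le_sup_right
    · rw [sup_eq_left.2 h]; exact le_sup_left

omit [Fintype ι] in
/-- The coordinatewise inclusion `[0,1]^ι → ℝ^ι` is a lattice homomorphism at every pair. [folklore] -/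
theorem coe_pi_lattice (x y : ι → I) :
    (fun i => ((x ⊓ y) i : ℝ)) = (fun i => (x i : ℝ)) ⊓ (fun i => (y i : ℝ)) ∧
      (fun i => ((x ⊔ y) i : ℝ)) = (fun i => (x i : ℝ)) ⊔ (fun i => (y i : ℝ)) := by
  refine ⟨funext fun i => ?_, funext fun i => ?_⟩
  · show ((x i ⊓ y i : I) : ℝ) = (x i : ℝ) ⊓ (y i : ℝ)
    refine le_antisymm (le_inf (Subtype.coe_le_coe.2 inf_le_left) (Subtype.coe_le_coe.2 inf_le_right)) ?_
    rcases le_total (x i) (y i) with h | h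
    · exact inf_le_left.trans (Subtype.coe_le_coe.2 (le_inf le_rfl h))
    · exact inf_le_right.trans (Subtype.coe_le_coe.2 (le_inf h le_rfl))
  · show ((x i ⊔ y i : I) : ℝ) = (x i : ℝ) ⊔ (y i : ℝ)
    refine le_antisymm ?_ (sup_le (Subtype.coe_le_coe.2 le_sup_left) (Subtype.coe_le_coe.2 le_sup_right))
    rcases le_total (x i) (y i) with h | h
    · exact (Subtype.coe_le_coe.2 (sup_le h le_rfl)).trans le_sup_right
    · exact (Subtype.coe_le_coe.2 (sup_le le_rfl h)).trans le_sup_left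

/-- **Lebesgue measure on the closed unit cube `ι → [0,1]` has the two-sided Borel-version property.**
[this work] -/
theorem hasPosBorelMTP2Versions_volume_unitCube : HasPosBorelMTP2Versions (volume : Measure (ι → I)) := by
  set μ : Measure (ι → ℝ) := (volume : Measure (ι → ℝ)).restrict (Set.pi univ fun _ => Icc (0 : ℝ) 1) with hμ
  have hP : HasPosBorelMTP2Versions μ := hasPosBorelMTP2Versions_volume_restrict_pi fun _ => Icc (0 : ℝ) 1
  set T : (ι → ℝ) → (ι → I) := fun x i => projIcc (0 : ℝ) 1 zero_le_one (x i) with hT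
  set R : (ι → I) → (ι → ℝ) := fun y i => (y i : ℝ) with hR
  have hTm : Measurable T :=
    measurable_pi_iff.2 fun i => continuous_projIcc.measurable.comp (measurable_pi_apply i)
  have hRmp : MeasurePreserving R (volume : Measure (ι → I)) μ := by
    rw [hμ, volume_pi, volume_pi, Measure.restrict_pi_pi]
    exact measurePreserving_pi _ _ fun _ => unitInterval.measurePreserving_coe
  have hTR : T ∘ R = id := funext fun y => funext fun i => projIcc_val zero_le_one (y i)
  have hmap : μ.map T = (volume : Measure (ι → I)) := by
    rw [← hRmp.map_eq, Measure.map_map hTm hRmp.measurable, hTR, Measure.map_id]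
  have hRT : ∀ᵐ x ∂μ, R (T x) = x := by
    filter_upwards [ae_restrict_mem (MeasurableSet.univ_pi fun _ => measurableSet_Icc)] with x hx
    exact funext fun i => congrArg Subtype.val (Set.projIcc_of_mem zero_le_one (Set.mem_univ_pi.1 hx i))
  exact hP.transport hTm hRmp.measurable (Eventually.of_forall fun p => projIcc_pi_lattice p.1 p.2) (by rw [hmap])
    (by rw [hmap]) coe_pi_lattice hRT

/-- **Unfolded, on `Q_ι = [0,1]^ι` with Lebesgue measure**: every measurable `f : Q_ι → [c, M]` (`0 < c`, `M < ∞`)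
which is MTP₂ on almost every pair has a Borel version `F = f` a.e., `0 < c' ≤ F ≤ M' < ∞`, with
`F(x) F(y) ≤ F(x ∧ y) F(x ∨ y)` for ALL `x, y`. [this work] -/
theorem exists_pos_measurable_mtp2_version_of_ae_unitCube (f : (ι → I) → ℝ≥0∞) (hf : Measurable f)
    {c M : ℝ≥0∞} (hc : c ≠ 0) (hM : M ≠ ∞) (hcf : ∀ x, c ≤ f x) (hfM : ∀ x, f x ≤ M)
    (hMTP : ∀ᵐ p ∂(volume : Measure (ι → I)).prod volume, f p.1 * f p.2 ≤ f (p.1 ⊓ p.2) * f (p.1 ⊔ p.2)) :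
    ∃ F : (ι → I) → ℝ≥0∞, Measurable F ∧ (∃ c' M' : ℝ≥0∞, c' ≠ 0 ∧ M' ≠ ∞ ∧ ∀ x, c' ≤ F x ∧ F x ≤ M') ∧
      F =ᵐ[volume] f ∧ ∀ x y, F x * F y ≤ F (x ⊓ y) * F (x ⊔ y) :=
  hasPosBorelMTP2Versions_volume_unitCube f hf c M hc hM hcf hfM hMTP

/-- **The additive form on `Q_ι`**: a bounded measurable `φ : [0,1]^ι → ℝ` which is supermodular on Lebesgue-almost
every pair has a bounded Borel version supermodular at every pair (pull back to `ℝ^ι` along the inclusion / push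
forward along `projIcc`). [this work] -/
theorem exists_measurable_supermodular_version_of_ae_unitCube (φ : (ι → I) → ℝ) (hφ : Measurable φ) {K : ℝ}
    (hK : ∀ x, |φ x| ≤ K)
    (hsm : ∀ᵐ p ∂(volume : Measure (ι → I)).prod volume, φ p.1 + φ p.2 ≤ φ (p.1 ⊓ p.2) + φ (p.1 ⊔ p.2)) :
    ∃ ψ : (ι → I) → ℝ, Measurable ψ ∧ (∃ K' : ℝ, ∀ x, |ψ x| ≤ K') ∧ ψ =ᵐ[volume] φ ∧
      ∀ x y, ψ x + ψ y ≤ ψ (x ⊓ y) + ψ (x ⊔ y) := by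
  -- pull back to `ℝ^ι` restricted to the closed cube
  set μ : Measure (ι → ℝ) := (volume : Measure (ι → ℝ)).restrict (Set.pi univ fun _ => Icc (0 : ℝ) 1) with hμ
  set T : (ι → ℝ) → (ι → I) := fun x i => projIcc (0 : ℝ) 1 zero_le_one (x i) with hT
  set R : (ι → I) → (ι → ℝ) := fun y i => (y i : ℝ) with hR
  have hTm : Measurable T :=
    measurable_pi_iff.2 fun i => continuous_projIcc.measurable.comp (measurable_pi_apply i)
  have hRmp : MeasurePreserving R (volume : Measure (ι → I)) μ := by
    rw [hμ, volume_pi, volume_pi, Measure.restrict_pi_pi]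
    exact measurePreserving_pi _ _ fun _ => unitInterval.measurePreserving_coe
  have hTR : ∀ y, T (R y) = y := fun y => funext fun i => projIcc_val zero_le_one (y i)
  have hmap : μ.map T = (volume : Measure (ι → I)) := by
    rw [← hRmp.map_eq, Measure.map_map hTm hRmp.measurable]
    have : T ∘ R = id := funext hTR
    rw [this, Measure.map_id]
  have hqmp : Measure.QuasiMeasurePreserving T μ (volume : Measure (ι → I)) := ⟨hTm, by rw [hmap]⟩
  have hqmp2 := MeasureTheory.QuasiMeasurePreserving.prodMap hqmp hqmp
  have hsm' : ∀ᵐ p ∂μ.prod μ, φ (T p.1) + φ (T p.2) ≤ φ (T (p.1 ⊓ p.2)) + φ (T (p.1 ⊔ p.2)) := by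
    filter_upwards [hqmp2.ae hsm] with p hp
    have hl := projIcc_pi_lattice p.1 p.2
    simp only [hT]
    rw [hl.1, hl.2]
    exact hp
  obtain ⟨ψ', hψ'm, ⟨K', hK'⟩, hψ'φ, hψ'sm⟩ :=
    ((hasPosBorelMTP2Versions_volume_restrict_pi fun _ : ι => Icc (0 : ℝ) 1).exists_supermodular_version
      (φ ∘ T) (hφ.comp hTm) (fun x => hK (T x)) hsm')
  refine ⟨ψ' ∘ R, hψ'm.comp hRmp.measurable, ⟨K', fun y => hK' (R y)⟩, ?_, fun x y => ?_⟩
  · -- `ψ' ∘ R = φ` a.e.: `ψ' = φ ∘ T` `μ`-a.e., `R_* vol = μ`, `T ∘ R = id`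
    have h1 : ∀ᵐ x ∂μ, ψ' x = φ (T x) := hψ'φ
    have h2 : ∀ᵐ y ∂(volume : Measure (ι → I)), ψ' (R y) = φ (T (R y)) := hRmp.quasiMeasurePreserving.ae h1
    filter_upwards [h2] with y hy
    rw [Function.comp_apply, hy, hTR y]
  · have hl := coe_pi_lattice x y
    simp only [Function.comp_apply, hR]
    rw [hl.1, hl.2]
    exact hψ'sm _ _

end Summit.CriticalPhenomena.PercolationContinuityZ3.Theorems.SahiAEFourFunctions
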